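import Literature.RepresentationTheory.CompactGroups.UnitaryGroupTwoIrreducibleCharacters
import HarnessLib

/-!
# Pieri's rule for `U(2)` on the diagonal torus: `h_{i+1} h_{j+1} − u₀u₁ · h_i h_j = h_{i+j+2}`

Topic `RepresentationTheory/CompactGroups`; namespace `Literature.RepresentationTheory.CompactGroups.UnitaryTwo`.
Theorems only (no definition, no named fact, no instance, no `sorry`).  With the complete homogeneous polynomials
`h_n(u) = Σ_{p ≤ n} u₀^p u₁^{n−p}` on the torus `U(1)²` — the irreducible characters of `U(2)` with `b = 0` of
★ `UnitaryGroupTwoIrreducibleCharacters` (`χ = (u₀u₁)^b h_a`) — PIERI'S RULE for two variables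
(Macdonald I (5.16); Bröcker–tom Dieck VI (1.7) for `U(2)`; the Clebsch–Gordan rule `Sym^i ⊗ Sym^j = Sym^{i+j} ⊕ det ⊗ (Sym^{i−1} ⊗ Sym^{j−1})`)
reads `h_i h_j = h_{i+j} + u₀u₁ · h_{i−1} h_{j−1}`:

* `torusChar_succ_mul_torusChar_succ` — `h_{i+1}(u) h_{j+1}(u) − u₀u₁ h_i(u) h_j(u) = h_{i+j+2}(u)`;
* `torusChar_inv` — `h_n(u⁻¹) = (u₀u₁)^{−n} h_n(u)` (the dual character);
* `torusChar_succ_mul_torusChar_succ_inv` — the form used for the harmonics of `U(2,1)`: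
  `h_{i+1}(u) h_{j+1}(u⁻¹) − h_i(u) h_j(u⁻¹) = (u₀u₁)^{−(j+1)} h_{i+j+2}(u)`, i.e. the virtual character
  `Sym^{i+1}(𝔭⁺) ⊗ Sym^{j+1}(𝔭⁻) ⊖ Sym^i(𝔭⁺) ⊗ Sym^j(𝔭⁻)` restricted to `U(2)` is the irreducible character with
  `(a, b) = (i+j+2, −(j+1))` [Knapp1986, proof of Thm. 10.2].

Proof: multiply by `(u₀ − u₁)²`, use `(u₀ − u₁) h_n = u₀^{n+1} − u₁^{n+1}` (★ `sub_mul_torusChar`) and divide back on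
the torus by ★ `eq_zero_of_sub_mul_eq_zero`.  Written for the `hodgecm-mathlib` cell (road V19, node N3); generic.

## References
* T. Bröcker, T. tom Dieck, *Representations of Compact Lie Groups*, GTM 98 (1985), II (5.5), VI (1.7) [BrockerTomDieck1985].
* A. W. Knapp, *Representation Theory of Semisimple Groups* (1986), proof of Thm. 10.2 [Knapp1986].
-/

set_option autoImplicit false

noncomputable section

open Finset

namespace Literature.RepresentationTheory.CompactGroups

namespace UnitaryTwo

/-- `(u₀ − u₁) · h_n(u) = u₀^{n+1} − u₁^{n+1}`. [cite: BrockerTomDieck1985, VI (1.7)] -/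
theorem sub_mul_torusChar_zero (n : ℕ) (u : Fin 2 → Circle) :
    ((u 0 : ℂ) - u 1) * ∑ p ∈ range (n + 1), (u 0 : ℂ) ^ p * (u 1 : ℂ) ^ (n - p) =
      (u 0 : ℂ) ^ (n + 1) - (u 1 : ℂ) ^ (n + 1) := by
  have h := sub_mul_torusChar n 0 u
  simp only [zpow_zero, one_mul, add_zero, mul_one] at h
  rw [h]
  norm_cast

/-- The continuity of `h_n` on the torus. [cite: BrockerTomDieck1985, VI (1.7)] -/
theorem continuous_torusChar_zero (n : ℕ) :
    Continuous fun u : Fin 2 → Circle => ∑ p ∈ range (n + 1), (u 0 : ℂ) ^ p * (u 1 : ℂ) ^ (n - p) := by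
  have h := continuous_torusChar n 0
  simp only [zpow_zero, one_mul] at h
  exact h

/-- **PIERI'S RULE FOR `U(2)` ON THE TORUS**: `h_{i+1}(u) · h_{j+1}(u) − u₀u₁ · h_i(u) · h_j(u) = h_{i+j+2}(u)`
(`Sym^{i+1} ⊗ Sym^{j+1} ≅ Sym^{i+j+2} ⊕ det ⊗ (Sym^i ⊗ Sym^j)` at the level of characters).
[cite: BrockerTomDieck1985, II (5.5)] [cite: BrockerTomDieck1985, VI (1.7)] -/
theorem torusChar_succ_mul_torusChar_succ (i j : ℕ) (u : Fin 2 → Circle) :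
    (∑ p ∈ range (i + 2), (u 0 : ℂ) ^ p * (u 1 : ℂ) ^ (i + 1 - p)) *
        (∑ p ∈ range (j + 2), (u 0 : ℂ) ^ p * (u 1 : ℂ) ^ (j + 1 - p)) -
      (u 0 : ℂ) * u 1 * ((∑ p ∈ range (i + 1), (u 0 : ℂ) ^ p * (u 1 : ℂ) ^ (i - p)) *
        ∑ p ∈ range (j + 1), (u 0 : ℂ) ^ p * (u 1 : ℂ) ^ (j - p)) =
      ∑ p ∈ range (i + j + 3), (u 0 : ℂ) ^ p * (u 1 : ℂ) ^ (i + j + 2 - p) := by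
  -- `F := LHS − RHS` is continuous and `(u₀ − u₁)² F = 0`; divide twice on the torus
  let F : (Fin 2 → Circle) → ℂ := fun u =>
    (∑ p ∈ range (i + 2), (u 0 : ℂ) ^ p * (u 1 : ℂ) ^ (i + 1 - p)) *
        (∑ p ∈ range (j + 2), (u 0 : ℂ) ^ p * (u 1 : ℂ) ^ (j + 1 - p)) -
      (u 0 : ℂ) * u 1 * ((∑ p ∈ range (i + 1), (u 0 : ℂ) ^ p * (u 1 : ℂ) ^ (i - p)) *
        ∑ p ∈ range (j + 1), (u 0 : ℂ) ^ p * (u 1 : ℂ) ^ (j - p)) -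
      ∑ p ∈ range (i + j + 3), (u 0 : ℂ) ^ p * (u 1 : ℂ) ^ (i + j + 2 - p)
  have hFc : Continuous F := by
    refine ((((continuous_torusChar_zero (i + 1)).mul (continuous_torusChar_zero (j + 1))).sub
      (((continuous_subtype_val.comp (continuous_apply 0)).mul (continuous_subtype_val.comp (continuous_apply 1))).mul
        ((continuous_torusChar_zero i).mul (continuous_torusChar_zero j)))).sub
      (continuous_torusChar_zero (i + j + 2))).congr fun u => ?_
    rfl
  have hsq : ∀ u : Fin 2 → Circle, ((u 0 : ℂ) - u 1) * (((u 0 : ℂ) - u 1) * F u) = 0 := by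
    intro u
    have h1 := sub_mul_torusChar_zero (i + 1) u
    have h2 := sub_mul_torusChar_zero (j + 1) u
    have h3 := sub_mul_torusChar_zero i u
    have h4 := sub_mul_torusChar_zero j u
    have h5 := sub_mul_torusChar_zero (i + j + 2) u
    simp only [F]
    -- `(u₀−u₁)²(h_{i+1}h_{j+1} − u₀u₁ h_i h_j − h_{i+j+2}) = 0`
    linear_combination ((u 0 : ℂ) ^ (j + 2) - (u 1 : ℂ) ^ (j + 2)) * h1 +
      ((u 0 : ℂ) - u 1) * (∑ p ∈ range (i + 2), (u 0 : ℂ) ^ p * (u 1 : ℂ) ^ (i + 1 - p)) * h2 -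
      (u 0 : ℂ) * u 1 * (((u 0 : ℂ) ^ (j + 1) - (u 1 : ℂ) ^ (j + 1)) * h3 +
        ((u 0 : ℂ) - u 1) * (∑ p ∈ range (i + 1), (u 0 : ℂ) ^ p * (u 1 : ℂ) ^ (i - p)) * h4) -
      ((u 0 : ℂ) - u 1) * h5
  have hlin : ∀ u : Fin 2 → Circle, ((u 0 : ℂ) - u 1) * F u = 0 :=
    eq_zero_of_sub_mul_eq_zero (((continuous_subtype_val.comp (continuous_apply 0)).sub
      (continuous_subtype_val.comp (continuous_apply 1))).mul hFc) hsq
  have hF : F u = 0 := eq_zero_of_sub_mul_eq_zero hFc hlin u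
  exact sub_eq_zero.mp hF

/-- **The dual character**: `h_n(u⁻¹) = (u₀u₁)^{−n} h_n(u)`. [cite: BrockerTomDieck1985, VI (1.7)] -/
theorem torusChar_inv (n : ℕ) (u : Fin 2 → Circle) :
    ∑ p ∈ range (n + 1), ((u⁻¹) 0 : ℂ) ^ p * ((u⁻¹) 1 : ℂ) ^ (n - p) =
      ((u 0 : ℂ) * u 1) ^ (-(n : ℤ)) * ∑ p ∈ range (n + 1), (u 0 : ℂ) ^ (n - p) * (u 1 : ℂ) ^ p := by
  have h0 : (u 0 : ℂ) ≠ 0 := Circle.coe_ne_zero _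
  have h1 : (u 1 : ℂ) ≠ 0 := Circle.coe_ne_zero _
  rw [Finset.mul_sum]
  refine Finset.sum_congr rfl fun p hp => ?_
  obtain ⟨q, rfl⟩ : ∃ q, n = p + q := ⟨n - p, (Nat.add_sub_cancel' (Nat.lt_succ_iff.mp (mem_range.mp hp))).symm⟩
  simp only [Pi.inv_apply, Circle.coe_inv, Nat.add_sub_cancel_left, zpow_neg, zpow_natCast, mul_pow, inv_pow, pow_add]
  field_simp

/-- `h_n` is symmetric: reversing the summation index. [cite: BrockerTomDieck1985, VI (1.7)] -/
theorem torusChar_reverse (n : ℕ) (u : Fin 2 → Circle) :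
    ∑ p ∈ range (n + 1), (u 0 : ℂ) ^ (n - p) * (u 1 : ℂ) ^ p = ∑ p ∈ range (n + 1), (u 0 : ℂ) ^ p * (u 1 : ℂ) ^ (n - p) := by
  rw [← Finset.sum_range_reflect]
  refine Finset.sum_congr rfl fun p hp => ?_
  have hpn : p ≤ n := Nat.lt_succ_iff.mp (mem_range.mp hp)
  rw [Nat.add_sub_cancel, Nat.sub_sub_self hpn]

/-- **PIERI FOR THE HARMONICS OF `U(2,1)`**: `h_{i+1}(u) h_{j+1}(u⁻¹) − h_i(u) h_j(u⁻¹) = (u₀u₁)^{−(j+1)} h_{i+j+2}(u)` — the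
virtual character `Sym^{i+1}(𝔭⁺) ⊗ Sym^{j+1}(𝔭⁻) ⊖ Sym^i(𝔭⁺) ⊗ Sym^j(𝔭⁻)` on the torus of `U(2)` is the irreducible
character with highest weight `(i+1, −(j+1))`, i.e. `(a, b) = (i+j+2, −(j+1))`. [cite: Knapp1986, Thm. 10.2 (proof)]
[cite: BrockerTomDieck1985, VI (1.7)] -/
theorem torusChar_succ_mul_torusChar_succ_inv (i j : ℕ) (u : Fin 2 → Circle) :
    (∑ p ∈ range (i + 2), (u 0 : ℂ) ^ p * (u 1 : ℂ) ^ (i + 1 - p)) *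
        (∑ p ∈ range (j + 2), ((u⁻¹) 0 : ℂ) ^ p * ((u⁻¹) 1 : ℂ) ^ (j + 1 - p)) -
      (∑ p ∈ range (i + 1), (u 0 : ℂ) ^ p * (u 1 : ℂ) ^ (i - p)) *
        (∑ p ∈ range (j + 1), ((u⁻¹) 0 : ℂ) ^ p * ((u⁻¹) 1 : ℂ) ^ (j - p)) =
      ((u 0 : ℂ) * u 1) ^ (-((j : ℤ) + 1)) * ∑ p ∈ range (i + j + 3), (u 0 : ℂ) ^ p * (u 1 : ℂ) ^ (i + j + 2 - p) := by
  have h0 : (u 0 : ℂ) ≠ 0 := Circle.coe_ne_zero _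
  have h1 : (u 1 : ℂ) ≠ 0 := Circle.coe_ne_zero _
  have hne : ((u 0 : ℂ) * u 1) ≠ 0 := mul_ne_zero h0 h1
  rw [torusChar_inv (j + 1) u, torusChar_inv j u, torusChar_reverse, torusChar_reverse,
    ← torusChar_succ_mul_torusChar_succ i j u, show ((j + 1 : ℕ) : ℤ) = (j : ℤ) + 1 by push_cast; ring]
  rw [show -((j : ℤ) + 1) = -(j : ℤ) - 1 by ring, zpow_sub₀ hne, zpow_neg, zpow_one]
  field_simp

end UnitaryTwo

end Literature.RepresentationTheory.CompactGroups

end
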